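import Mathlib.Topology.Algebra.InfiniteSum.Real
import Mathlib.Order.LiminfLimsup
import Mathlib.Topology.Order.LiminfLimsup
import Mathlib.Algebra.Order.Ring.Abs
import HarnessLib

/-!
# The effective one-dimensional stacking functional on Hägg sequences

Definition request `defn-haggStackingEnergy` (route `AtomisticToContinuum/RefuteCrystalPeriodicMin`,
wanted by `stmt-AtomisticToContinuum-0671`; companion of `defn-BarlowStacking`). A close-packed
(Barlow) stacking is coded by its **Hägg sequence** `s : ℤ → {+1, −1}` (`sₘ = +1` if layer `m+1`
follows layer `m` cyclically `A → B → C → A`, `−1` otherwise); layers `m` and `m + k` are laterally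
**aligned** (same letter) iff the window sum `sₘ + ⋯ + s_{m+k-1} ≡ 0 (mod 3)`. For couplings
`J : ℕ → ℝ` (`J k` = aligned-minus-non-aligned interlayer energy at layer distance `k`, `k ≥ 2`)
the effective functional of the route is

* `haggEnergyTrunc K n J s = H_n^K(J, s) = ∑_{m<n} ∑_{k=2}^{K} J_k · 1[s_m + ⋯ + s_{m+k-1} ≡ 0 (3)]`
  (finite range `K`; literally the right-hand side of `stmt-AtomisticToContinuum-0716`);
* `haggEnergy n J s = H_n(J, s) = ∑_{m<n} ∑'_{k ≥ 2} J_k · 1[aligned]` (all ranges, a `tsum`);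
* `haggStackingEnergy J s = liminf_n H_n(J, s) / n` — the **stacking energy density**.

This is a one-dimensional lattice model with competing finite/summable-range interactions in the
spirit of the ANNNI/A3NNI descriptions of polytypism (Pártay–Ortner–Csányi 2017, §1 and
Appendix A: layers `A, B, C`, "hexagonal (ABA) or cubic (ABC)", `h`/`c` and Zhdanov notation);
Radin–Schulman 1983 is the source for periodic ground states of finite-range 1-D models. The
functional itself is the route's construction; all lemmas here are elementary ([folklore]).

## Main results (all proved)

* `haggEnergyTrunc_eq` — `H_n^K` unfolds to the `0716` expression (`rfl`);
* alternating sequence `alternatingHagg m = (−1)^m` (HCP, `ABAB…`): `haggWindow_alternating`,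
  `haggAligned_alternating_iff : aligned ↔ Even k`, `haggEnergyTrunc_alternating = n · ∑_{k even ≤ K} J_k`,
  `haggEnergy_alternating`, `haggStackingEnergy_alternating = ∑'_{k ≥ 2 even} J_k`;
* constant sequence `constHagg = 1` (FCC, `ABCABC…`): `haggAligned_const_iff : aligned ↔ 3 ∣ k`,
  `haggEnergyTrunc_const = n · ∑_{3 ∣ k ≤ K} J_k`, `haggEnergy_const`, `haggStackingEnergy_const`;
* shift/period invariance: `haggWindow_shift`, `haggLocalEnergyTrunc_periodic`,
  `haggEnergyTrunc_shift_of_periodic` (the per-period energy of an `n`-periodic sequence is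
  invariant under the shift `s ↦ s(· + 1)`), and likewise for `haggEnergy`;
* `abs_haggLocalEnergyTrunc_le : |∑_{k ≤ K} …| ≤ ∑_{k=2}^{K} |J_k|`.

## References

* L. B. Pártay, C. Ortner, A. P. Bartók, C. J. Pickard, G. Csányi, *Polytypism in the ground state
  structure of the Lennard-Jonesium*, PCCP 19 (2017), §1–§2 and Appendix A. arXiv:1705.01751.
* C. Radin, L. S. Schulman, *Periodicity of classical ground states*, Phys. Rev. Lett. 51 (1983)
  621–622.
-/

noncomputable section

open Filter Finset
open scoped Topology

namespace Literature.MathematicalPhysics.StatisticalMechanics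

/-! ## Windows and alignment -/

/-- A **Hägg sequence**: a `±1`-valued sequence on `ℤ`. [cite: PartayOrtnerCsanyi2017, Appendix A] -/
def IsHaggSeq (s : ℤ → ℤ) : Prop :=
  ∀ i, s i = 1 ∨ s i = -1

/-- The window sum `s_m + s_{m+1} + ⋯ + s_{m+k-1}` (net cyclic shift `A → B → C` between layers
`m` and `m + k`). [folklore] -/
def haggWindow (s : ℤ → ℤ) (m : ℤ) (k : ℕ) : ℤ :=
  ∑ i ∈ range k, s (m + i)

/-- Layers `m` and `m + k` of the stacking coded by `s` are **aligned** (carry the same letter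
`A/B/C`) iff the window sum is `≡ 0 (mod 3)` (an `abbrev`, so that `if HaggAligned … then` uses the
integer decidability instance). [folklore] -/
abbrev HaggAligned (s : ℤ → ℤ) (m : ℤ) (k : ℕ) : Prop :=
  haggWindow s m k % 3 = 0

/-- Unfolding `haggWindow`. [folklore] -/
theorem haggWindow_eq (s : ℤ → ℤ) (m : ℤ) (k : ℕ) :
    haggWindow s m k = ∑ i ∈ range k, s (m + i) := rfl

/-- Unfolding `HaggAligned`. [folklore] -/
theorem haggAligned_iff (s : ℤ → ℤ) (m : ℤ) (k : ℕ) :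
    HaggAligned s m k ↔ (∑ i ∈ range k, s (m + i)) % 3 = 0 := Iff.rfl

/-- `haggWindow s m 0 = 0`. [folklore] -/
@[simp] theorem haggWindow_zero (s : ℤ → ℤ) (m : ℤ) : haggWindow s m 0 = 0 := by
  simp [haggWindow]

/-- `haggWindow s m (k+1) = haggWindow s m k + s (m + k)`. [folklore] -/
theorem haggWindow_succ (s : ℤ → ℤ) (m : ℤ) (k : ℕ) :
    haggWindow s m (k + 1) = haggWindow s m k + s (m + k) := by
  simp [haggWindow, sum_range_succ]

/-- Windows of the shifted sequence: `window (s(·+1)) m k = window s (m+1) k`. [folklore] -/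
theorem haggWindow_shift (s : ℤ → ℤ) (m : ℤ) (k : ℕ) :
    haggWindow (fun i => s (i + 1)) m k = haggWindow s (m + 1) k := by
  simp only [haggWindow]
  exact sum_congr rfl fun i _ => by ring_nf

/-- Windows of an `n`-periodic sequence are `n`-periodic in the base point. [folklore] -/
theorem haggWindow_periodic {s : ℤ → ℤ} {n : ℕ} (hs : ∀ i, s (i + n) = s i) (m : ℤ) (k : ℕ) :
    haggWindow s (m + n) k = haggWindow s m k := by
  simp only [haggWindow]
  exact sum_congr rfl fun i _ => by rw [show m + n + i = m + i + n by ring, hs]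

/-! ## Finite-volume energies -/

/-- The **local energy at layer `m`, range `≤ K`**: `∑_{k=2}^{K} J_k · 1[layers m, m+k aligned]`.
[folklore] -/
def haggLocalEnergyTrunc (K : ℕ) (J : ℕ → ℝ) (s : ℤ → ℤ) (m : ℤ) : ℝ :=
  ∑ k ∈ Icc 2 K, if HaggAligned s m k then J k else 0

/-- The **local energy at layer `m`** (all ranges): `∑'_{k ≥ 2} J_k · 1[layers m, m+k aligned]`
(a `tsum`; equals the finite sum when `J` is finitely supported, `0` if not summable). [folklore] -/
def haggLocalEnergy (J : ℕ → ℝ) (s : ℤ → ℤ) (m : ℤ) : ℝ :=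
  ∑' k : ℕ, if 2 ≤ k ∧ HaggAligned s m k then J k else 0

/-- **`H_n^K(J, s) = ∑_{m<n} ∑_{k=2}^{K} J_k · 1[s_m + ⋯ + s_{m+k-1} ≡ 0 (3)]`** — the finite-range,
finite-volume stacking energy (per period, for `n`-periodic `s`). [folklore] -/
def haggEnergyTrunc (K n : ℕ) (J : ℕ → ℝ) (s : ℤ → ℤ) : ℝ :=
  ∑ m ∈ range n, haggLocalEnergyTrunc K J s m

/-- **`H_n(J, s) = ∑_{m<n} ∑'_{k ≥ 2} J_k · 1[aligned]`** — the finite-volume stacking energy.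
[folklore] -/
def haggEnergy (n : ℕ) (J : ℕ → ℝ) (s : ℤ → ℤ) : ℝ :=
  ∑ m ∈ range n, haggLocalEnergy J s m

/-- **The stacking energy density** `h(J, s) = liminf_n H_n(J, s)/n`. [folklore] -/
def haggStackingEnergy (J : ℕ → ℝ) (s : ℤ → ℤ) : ℝ :=
  liminf (fun n : ℕ => haggEnergy n J s / n) atTop

/-- `H_n^K` is literally the expression of `stmt-AtomisticToContinuum-0716`. [folklore] -/
theorem haggEnergyTrunc_eq (K n : ℕ) (J : ℕ → ℝ) (s : ℤ → ℤ) :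
    haggEnergyTrunc K n J s = ∑ m ∈ range n, ∑ k ∈ Icc 2 K,
      (if (∑ i ∈ range k, s ((m : ℤ) + i)) % 3 = 0 then J k else 0) := rfl

/-- The truncated local energy as a filtered sum. [folklore] -/
theorem haggLocalEnergyTrunc_eq_sum_filter (K : ℕ) (J : ℕ → ℝ) (s : ℤ → ℤ) (m : ℤ) :
    haggLocalEnergyTrunc K J s m = ∑ k ∈ (Icc 2 K).filter (fun k => HaggAligned s m k), J k := by
  rw [haggLocalEnergyTrunc, sum_filter]

/-- `|∑_{k=2}^{K} J_k 1[aligned]| ≤ ∑_{k=2}^{K} |J_k|`. [folklore] -/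
theorem abs_haggLocalEnergyTrunc_le (K : ℕ) (J : ℕ → ℝ) (s : ℤ → ℤ) (m : ℤ) :
    |haggLocalEnergyTrunc K J s m| ≤ ∑ k ∈ Icc 2 K, |J k| := by
  refine (abs_sum_le_sum_abs _ _).trans (sum_le_sum fun k _ => ?_)
  split_ifs <;> simp

/-- If `J` vanishes beyond `K`, the full local energy is the truncated one. [folklore] -/
theorem haggLocalEnergy_eq_trunc {K : ℕ} {J : ℕ → ℝ} (hJ : ∀ k, K < k → J k = 0) (s : ℤ → ℤ)
    (m : ℤ) : haggLocalEnergy J s m = haggLocalEnergyTrunc K J s m := by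
  rw [haggLocalEnergy, haggLocalEnergyTrunc, tsum_eq_sum (s := Icc 2 K)]
  · refine sum_congr rfl fun k hk => ?_
    simp [(mem_Icc.mp hk).1]
  · intro k hk
    simp only [mem_Icc, not_and_or, not_le] at hk
    rcases hk with hk | hk
    · simp [show ¬ (2 ≤ k) by omega]
    · simp [hJ k hk]

/-! ## Periodicity and shift invariance -/

/-- Local energies of an `n`-periodic sequence are `n`-periodic. [folklore] -/
theorem haggLocalEnergyTrunc_periodic {s : ℤ → ℤ} {n : ℕ} (hs : ∀ i, s (i + n) = s i) (K : ℕ)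
    (J : ℕ → ℝ) (m : ℤ) : haggLocalEnergyTrunc K J s (m + n) = haggLocalEnergyTrunc K J s m := by
  simp [haggLocalEnergyTrunc, HaggAligned, haggWindow_periodic hs]

/-- Local energies of an `n`-periodic sequence are `n`-periodic (all ranges). [folklore] -/
theorem haggLocalEnergy_periodic {s : ℤ → ℤ} {n : ℕ} (hs : ∀ i, s (i + n) = s i) (J : ℕ → ℝ)
    (m : ℤ) : haggLocalEnergy J s (m + n) = haggLocalEnergy J s m := by
  simp [haggLocalEnergy, HaggAligned, haggWindow_periodic hs]

/-- Local energy of the shifted sequence. [folklore] -/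
theorem haggLocalEnergyTrunc_shift (K : ℕ) (J : ℕ → ℝ) (s : ℤ → ℤ) (m : ℤ) :
    haggLocalEnergyTrunc K J (fun i => s (i + 1)) m = haggLocalEnergyTrunc K J s (m + 1) := by
  simp [haggLocalEnergyTrunc, HaggAligned, haggWindow_shift]

/-- Local energy of the shifted sequence (all ranges). [folklore] -/
theorem haggLocalEnergy_shift (J : ℕ → ℝ) (s : ℤ → ℤ) (m : ℤ) :
    haggLocalEnergy J (fun i => s (i + 1)) m = haggLocalEnergy J s (m + 1) := by
  simp [haggLocalEnergy, HaggAligned, haggWindow_shift]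

/-- A sum over a full period is shift invariant. [folklore] -/
theorem sum_range_shift_of_periodic {f : ℤ → ℝ} {n : ℕ} (hf : ∀ m, f (m + n) = f m) :
    ∑ m ∈ range n, f ((m : ℤ) + 1) = ∑ m ∈ range n, f m := by
  have h1 : ∑ m ∈ range (n + 1), f (m : ℤ) = ∑ m ∈ range n, f ((m : ℤ) + 1) + f 0 := by
    rw [sum_range_succ']; simp
  have h2 : ∑ m ∈ range (n + 1), f (m : ℤ) = ∑ m ∈ range n, f (m : ℤ) + f n := sum_range_succ _ _
  have h3 : f (n : ℤ) = f 0 := by simpa using hf 0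
  linarith

/-- **Shift invariance of the per-period energy**: for `n`-periodic `s`,
`H_n^K(J, s(·+1)) = H_n^K(J, s)`. [folklore] -/
theorem haggEnergyTrunc_shift_of_periodic {s : ℤ → ℤ} {n : ℕ} (hs : ∀ i, s (i + n) = s i) (K : ℕ)
    (J : ℕ → ℝ) : haggEnergyTrunc K n J (fun i => s (i + 1)) = haggEnergyTrunc K n J s := by
  simp only [haggEnergyTrunc, haggLocalEnergyTrunc_shift]
  exact sum_range_shift_of_periodic (haggLocalEnergyTrunc_periodic hs K J)

/-- **Shift invariance of the per-period energy** (all ranges). [folklore] -/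
theorem haggEnergy_shift_of_periodic {s : ℤ → ℤ} {n : ℕ} (hs : ∀ i, s (i + n) = s i)
    (J : ℕ → ℝ) : haggEnergy n J (fun i => s (i + 1)) = haggEnergy n J s := by
  simp only [haggEnergy, haggLocalEnergy_shift]
  exact sum_range_shift_of_periodic (haggLocalEnergy_periodic hs J)

/-! ## The alternating sequence (HCP) -/

/-- The alternating Hägg sequence `(−1)^m` (`ABAB…`, the HCP stacking).
[cite: PartayOrtnerCsanyi2017, §1 ("hexagonal (in ABA stacking)")] -/
def alternatingHagg : ℤ → ℤ := fun m => if Even m then 1 else -1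

/-- The alternating sequence is a Hägg sequence. [folklore] -/
theorem isHaggSeq_alternating : IsHaggSeq alternatingHagg := fun i => by
  unfold alternatingHagg; split_ifs <;> simp

/-- The alternating sequence is `2`-periodic. [folklore] -/
theorem alternatingHagg_periodic (i : ℤ) : alternatingHagg (i + 2) = alternatingHagg i := by
  simp [alternatingHagg]

/-- Window sums of the alternating sequence: `0` for even length, `±1` for odd length. [folklore] -/
theorem haggWindow_alternating (m : ℤ) (k : ℕ) :
    haggWindow alternatingHagg m k = if Even k then 0 else alternatingHagg m := by
  induction k with
  | zero => simp
  | succ k ih =>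
    rw [haggWindow_succ, ih]
    by_cases hk : Even k
    · have hk' : ¬ Even (k + 1) := by simpa [Nat.even_add_one] using hk
      have : alternatingHagg (m + k) = alternatingHagg m := by
        simp [alternatingHagg, Int.even_add, Int.even_coe_nat, hk]
      simp [hk, hk', this]
    · have hk' : Even (k + 1) := by simpa [Nat.even_add_one] using hk
      have : alternatingHagg (m + k) = -alternatingHagg m := by
        unfold alternatingHagg
        by_cases hm : Even m <;> simp [Int.even_add, Int.even_coe_nat, hk, hm]
      simp [hk, hk', this]

/-- **In the alternating stacking, layers `m`, `m+k` are aligned iff `k` is even.** [folklore] -/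
theorem haggAligned_alternating_iff (m : ℤ) (k : ℕ) : HaggAligned alternatingHagg m k ↔ Even k := by
  rw [HaggAligned, haggWindow_alternating]
  by_cases hk : Even k
  · simp [hk]
  · simp only [hk, if_false, iff_false, alternatingHagg]
    split_ifs <;> decide

/-- Local energy of the alternating stacking: `∑_{k even, 2 ≤ k ≤ K} J_k`, independent of `m`.
[folklore] -/
theorem haggLocalEnergyTrunc_alternating (K : ℕ) (J : ℕ → ℝ) (m : ℤ) :
    haggLocalEnergyTrunc K J alternatingHagg m = ∑ k ∈ (Icc 2 K).filter Even, J k := by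
  rw [haggLocalEnergyTrunc_eq_sum_filter]
  congr 1
  ext k
  simp [haggAligned_alternating_iff]

/-- **`H_n^K` of the alternating stacking is `n · ∑_{k even ≤ K} J_k`** (the value in
`stmt-AtomisticToContinuum-0716`). [folklore] -/
theorem haggEnergyTrunc_alternating (K n : ℕ) (J : ℕ → ℝ) :
    haggEnergyTrunc K n J alternatingHagg = n * ∑ k ∈ (Icc 2 K).filter Even, J k := by
  simp [haggEnergyTrunc, haggLocalEnergyTrunc_alternating]

/-- Local energy of the alternating stacking, all ranges: `∑'_{k ≥ 2 even} J_k`. [folklore] -/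
theorem haggLocalEnergy_alternating (J : ℕ → ℝ) (m : ℤ) :
    haggLocalEnergy J alternatingHagg m = ∑' k : ℕ, if 2 ≤ k ∧ Even k then J k else 0 := by
  simp [haggLocalEnergy, haggAligned_alternating_iff]

/-- `H_n` of the alternating stacking is `n · ∑'_{k ≥ 2 even} J_k`. [folklore] -/
theorem haggEnergy_alternating (n : ℕ) (J : ℕ → ℝ) :
    haggEnergy n J alternatingHagg = n * ∑' k : ℕ, if 2 ≤ k ∧ Even k then J k else 0 := by
  simp [haggEnergy, haggLocalEnergy_alternating]

/-- A sequence eventually equal to a constant has that `liminf`. [folklore] -/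
theorem liminf_div_of_eq_mul (c : ℝ) {u : ℕ → ℝ} (hu : ∀ n, u n = n * c) :
    liminf (fun n : ℕ => u n / n) atTop = c := by
  have : (fun n : ℕ => u n / n) =ᶠ[atTop] fun _ => c := by
    filter_upwards [eventually_ge_atTop 1] with n hn
    have hn' : (n : ℝ) ≠ 0 := by exact_mod_cast (show n ≠ 0 by omega)
    rw [hu, mul_comm, mul_div_assoc, div_self hn', mul_one]
  rw [liminf_congr this, liminf_const]

/-- **The stacking energy density of HCP**: `h(J, ABAB…) = ∑'_{k ≥ 2 even} J_k`. [folklore] -/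
theorem haggStackingEnergy_alternating (J : ℕ → ℝ) :
    haggStackingEnergy J alternatingHagg = ∑' k : ℕ, if 2 ≤ k ∧ Even k then J k else 0 :=
  liminf_div_of_eq_mul _ fun n => haggEnergy_alternating n J

/-! ## The constant sequence (FCC) -/

/-- The constant Hägg sequence `+1` (`ABCABC…`, the FCC stacking).
[cite: PartayOrtnerCsanyi2017, §1 ("cubic (in ABC stacking)")] -/
def constHagg : ℤ → ℤ := fun _ => 1

/-- The constant sequence is a Hägg sequence and `1`-periodic. [folklore] -/
theorem isHaggSeq_const : IsHaggSeq constHagg := fun _ => Or.inl rfl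

/-- Window sums of the constant sequence: `k`. [folklore] -/
theorem haggWindow_const (m : ℤ) (k : ℕ) : haggWindow constHagg m k = k := by
  simp [haggWindow, constHagg]

/-- **In the FCC stacking, layers `m`, `m+k` are aligned iff `3 ∣ k`.** [folklore] -/
theorem haggAligned_const_iff (m : ℤ) (k : ℕ) : HaggAligned constHagg m k ↔ 3 ∣ k := by
  rw [HaggAligned, haggWindow_const]
  omega

/-- Local energy of FCC: `∑_{3 ∣ k, 2 ≤ k ≤ K} J_k`. [folklore] -/
theorem haggLocalEnergyTrunc_const (K : ℕ) (J : ℕ → ℝ) (m : ℤ) :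
    haggLocalEnergyTrunc K J constHagg m = ∑ k ∈ (Icc 2 K).filter (3 ∣ ·), J k := by
  rw [haggLocalEnergyTrunc_eq_sum_filter]
  congr 1
  ext k
  simp [haggAligned_const_iff]

/-- **`H_n^K` of FCC is `n · ∑_{3 ∣ k ≤ K} J_k`.** [folklore] -/
theorem haggEnergyTrunc_const (K n : ℕ) (J : ℕ → ℝ) :
    haggEnergyTrunc K n J constHagg = n * ∑ k ∈ (Icc 2 K).filter (3 ∣ ·), J k := by
  simp [haggEnergyTrunc, haggLocalEnergyTrunc_const]

/-- `H_n` of FCC is `n · ∑'_{3 ∣ k} J_k` (`k ≥ 2` automatic). [folklore] -/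
theorem haggEnergy_const (n : ℕ) (J : ℕ → ℝ) :
    haggEnergy n J constHagg = n * ∑' k : ℕ, if 2 ≤ k ∧ 3 ∣ k then J k else 0 := by
  simp [haggEnergy, haggLocalEnergy, haggAligned_const_iff]

/-- **The stacking energy density of FCC**: `h(J, ABC…) = ∑'_{k ≥ 2, 3 ∣ k} J_k`. [folklore] -/
theorem haggStackingEnergy_const (J : ℕ → ℝ) :
    haggStackingEnergy J constHagg = ∑' k : ℕ, if 2 ≤ k ∧ 3 ∣ k then J k else 0 :=
  liminf_div_of_eq_mul _ fun n => haggEnergy_const n J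

end Literature.MathematicalPhysics.StatisticalMechanics
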